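import Mathlib
import Summits.ValiantsHypothesis.ValiantsHypothesis.Theorems.RigidityForcesSymmetryRankRigidMinimalReprLaplaceFiveSeparatedCaptureK1Bridge
import Summits.ValiantsHypothesis.ValiantsHypothesis.Theorems.RigidityForcesSymmetryRankRigidMinimalReprLaplaceFiveSeparatedCaptureTwoEqualPlusLineSpans

/-!
# ValiantsHypothesis / RigidityForcesSymmetry — crux `LaplaceOptimalFive` (stmt-ValiantsHypothesis-24813), young-shadow K1:
# **K1 ON `K₃ ⊔ K₂` WHEN TWO TRIANGLE SHORT SPANS COINCIDE** (two equal short spans of dimension `≤ 2` and a third of dimension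
# `≤ 2` meeting them in a line, not contained in them)

K1 consumer (brick «B8») of ✓ `captureIneqSym_of_two_equal_plus_line` (the `(P, P, Q)` profile of `CaptureIneqSym`,
✓ `…SeparatedCaptureTwoEqualPlusLineSpans`) through the local bridge ✓ `sideSym_K32canon_of_captureAt` (✓ `…K1Bridge`), in the shape of
✓ `sideSym_K32canon_nested_line`: a side-symmetric split decomposition of `P₅` on `{01, 02, 12, 34}` two of whose triangle short spans
are EQUAL (dimension `≤ 2`) and whose third triangle short span (dimension `≤ 2`) meets them non-trivially without being contained in
them has Laplace weight `≥ 5! = 120` — for each of the three choices of the odd cut.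

* ★★ `sideSym_K32canon_two_equal_plus_line` (odd cut `{1,2}`);  ★ `…_two_equal_plus_line02` (odd cut `{0,2}`);
  ★ `…_two_equal_plus_line01` (odd cut `{0,1}`).

Honest framing.  A SUB-CASE of K1 on `K₃ ⊔ K₂`; the common-line profile, spans of dimension `≥ 3`, K1 on `K₃ ⊔ K₂` in general,
`CaptureIneqSym`, S2′, `LaplaceOptimalFive` (OPEN · CONTESTED 72/120), `RankRigidMinimalRepr`, `VP ≠ VNP` are NOT proved.
No definitions, no `sorry`.
-/

set_option linter.dupNamespace false
set_option autoImplicit false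

namespace Summit.ValiantsHypothesis.ValiantsHypothesis.Theorems.RigidityForcesSymmetryRankRigidMinimalRepr

namespace LaplaceFiveSeparatedCapture

open Finset LaplaceFiveSectorSplit

/-- ★★ **K1 ON `K₃ ⊔ K₂ = {01, 02, 12, 34}`, EQUAL SHORT SPANS ON `{0,1}` AND `{0,2}`**: the short spans on `{0,1}`, `{0,2}` coincide
and have dimension `≤ 2`, the short span on `{1,2}` has dimension `≤ 2`, meets them non-trivially and is not contained in them ⇒
Laplace weight `≥ 5! = 120`. [folklore] -/
theorem sideSym_K32canon_two_equal_plus_line {N : ℕ} (T : Finset (Fin N)) (S : Fin N → Finset (Fin 5))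
    (u w : Fin N → (Fin 5 → Fin 5) → ℂ) (hdec : IsSplitDecomposition T S u w) (hsym : SideSymmetric T S u w)
    (hC : ∀ t ∈ T, S t = ({0, 1} : Finset (Fin 5)) ∨ S t = ({0, 2} : Finset (Fin 5)) ∨
      S t = ({1, 2} : Finset (Fin 5)) ∨ S t = ({3, 4} : Finset (Fin 5)))
    (heq : shortSpan T S u 0 1 = shortSpan T S u 0 2) (h01 : Module.finrank ℂ (shortSpan T S u 0 1) ≤ 2)
    (h12 : Module.finrank ℂ (shortSpan T S u 1 2) ≤ 2) (hmeet : shortSpan T S u 0 1 ⊓ shortSpan T S u 1 2 ≠ ⊥)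
    (hnot : ¬ shortSpan T S u 1 2 ≤ shortSpan T S u 0 1) :
    Nat.factorial 5 ≤ laplaceWeight T S := by
  refine sideSym_K32canon_of_captureAt T S u w hdec hsym hC fun hs01 _ hs12 W hWs hWd hWc => ?_
  rw [← heq] at hWc ⊢
  exact captureIneqSym_of_two_equal_plus_line _ _ W hs01 hs12 h01 h12 hmeet hnot hWs hWd hWc

/-- ★ **Equal short spans on `{0,1}` and `{1,2}`, odd cut `{0,2}`** (✓ `captureIneqSym_of_two_equal_plus_line_02`). [folklore] -/
theorem sideSym_K32canon_two_equal_plus_line02 {N : ℕ} (T : Finset (Fin N)) (S : Fin N → Finset (Fin 5))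
    (u w : Fin N → (Fin 5 → Fin 5) → ℂ) (hdec : IsSplitDecomposition T S u w) (hsym : SideSymmetric T S u w)
    (hC : ∀ t ∈ T, S t = ({0, 1} : Finset (Fin 5)) ∨ S t = ({0, 2} : Finset (Fin 5)) ∨
      S t = ({1, 2} : Finset (Fin 5)) ∨ S t = ({3, 4} : Finset (Fin 5)))
    (heq : shortSpan T S u 0 1 = shortSpan T S u 1 2) (h01 : Module.finrank ℂ (shortSpan T S u 0 1) ≤ 2)
    (h02 : Module.finrank ℂ (shortSpan T S u 0 2) ≤ 2) (hmeet : shortSpan T S u 0 1 ⊓ shortSpan T S u 0 2 ≠ ⊥)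
    (hnot : ¬ shortSpan T S u 0 2 ≤ shortSpan T S u 0 1) :
    Nat.factorial 5 ≤ laplaceWeight T S := by
  refine sideSym_K32canon_of_captureAt T S u w hdec hsym hC fun hs01 hs02 _ W hWs hWd hWc => ?_
  rw [← heq] at hWc ⊢
  have h := captureIneqSym_of_two_equal_plus_line_02 _ _ W hs01 hs02 h01 h02 hmeet hnot hWs hWd hWc
  omega

/-- ★ **Equal short spans on `{0,2}` and `{1,2}`, odd cut `{0,1}`** (✓ `captureIneqSym_of_two_equal_plus_line_12`). [folklore] -/
theorem sideSym_K32canon_two_equal_plus_line01 {N : ℕ} (T : Finset (Fin N)) (S : Fin N → Finset (Fin 5))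
    (u w : Fin N → (Fin 5 → Fin 5) → ℂ) (hdec : IsSplitDecomposition T S u w) (hsym : SideSymmetric T S u w)
    (hC : ∀ t ∈ T, S t = ({0, 1} : Finset (Fin 5)) ∨ S t = ({0, 2} : Finset (Fin 5)) ∨
      S t = ({1, 2} : Finset (Fin 5)) ∨ S t = ({3, 4} : Finset (Fin 5)))
    (heq : shortSpan T S u 0 2 = shortSpan T S u 1 2) (h02 : Module.finrank ℂ (shortSpan T S u 0 2) ≤ 2)
    (h01 : Module.finrank ℂ (shortSpan T S u 0 1) ≤ 2) (hmeet : shortSpan T S u 0 2 ⊓ shortSpan T S u 0 1 ≠ ⊥)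
    (hnot : ¬ shortSpan T S u 0 1 ≤ shortSpan T S u 0 2) :
    Nat.factorial 5 ≤ laplaceWeight T S := by
  refine sideSym_K32canon_of_captureAt T S u w hdec hsym hC fun hs01 hs02 _ W hWs hWd hWc => ?_
  rw [← heq] at hWc ⊢
  have h := captureIneqSym_of_two_equal_plus_line_12 _ _ W hs02 hs01 h02 h01 hmeet hnot hWs hWd hWc
  omega

end LaplaceFiveSeparatedCapture

end Summit.ValiantsHypothesis.ValiantsHypothesis.Theorems.RigidityForcesSymmetryRankRigidMinimalRepr
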